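import Summits.QuantumFields.GaugeBoot.SOMasterLoopAssembly
import Literature.MathematicalPhysics.QuantumFieldTheory.Chatterjee2019LargeN.MasterLoopConvergence
import Literature.MathematicalPhysics.QuantumFieldTheory.Sweep1AreaLawProofs
import Mathlib.Analysis.Calculus.ParametricIntegral
import Mathlib.Analysis.SpecialFunctions.Log.Deriv
import HarnessLib

/-!
# The log-partition function of `SO(N)` lattice gauge theory as an integral of plaquette expectations (gauge-boot, ADDENDUM 28 part Z1)

HONEST FRAMING (cell `pub-gaugeboot`, page 1 of every file): the venture produces certified bounds
on lattice expectations at stated coupling, gauge group, dimension and torus size; NOT a mass gap,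
NOT a continuum limit, NOT a string tension; NOT Yang–Mills-summit-bearing (barriers
`FixedCouplingUltralocality`, `PerturbativeInvisibility`).  An exact finite-volume, finite-`N` identity for the free-boundary
`SO(N)` lattice gauge theory of S. Chatterjee, Comm. Math. Phys. **366** (2019); nothing about four-dimensional continuum
Yang–Mills or a mass gap.

## Content

The first step of the source's proof of Corollary 3.4 (§15, «`log Z_{Λ,N,β₁} = Σ_{p} N ∫₀^{β₁} ⟨W_p⟩_{Λ,N,β} dβ`», there
for the torus; here for the free boundary condition, where it holds verbatim since `Z_{Λ,N,0} = 1` as well):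

★ `log_soPartitionFunction_eq_integral` — for every finite `Λ ⊂ ℤ^d`, every `N` and every real `β₁`,
`log Z_{Λ,N,β₁} = ∫₀^{β₁} N Σ_{p ∈ 𝒫_Λ} ⟨tr Q_p⟩_{Λ,N,β} dβ`, with `Z` Chatterjee's partition function
(`soPartitionFunction`), `𝒫_Λ = plaquettesIn Λ`, `⟨·⟩_{Λ,N,β}` his expectation (`soExpect`).  Ingredients: differentiation
under the integral sign on the compact configuration space (`hasDerivAt_integral_pow_mul_exp`), `Z > 0`, the expectation as
a ratio of Haar integrals (tree `zdExpect_eq_div_integral`) and the fundamental theorem of calculus.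
★ `log_soPartitionFunction_eq_integral_phi` — the same with the integrand written as `N² Σ_p φ_{Λ,N,β}((∂p))`
(`φ(s) = ⟨W_{l₁}⋯⟩/Nⁿ`, `∂p` Chatterjee's plaquette word; `tr Q_p = W_{∂p}` by the lane's `plaquetteObs_eq_wilsonLoopVar`).

Everything is `[folklore]` given the source.
-/

noncomputable section

open MeasureTheory Filter Topology
open Literature.Probability.LatticeModels (Site)
open Literature.MathematicalPhysics.QuantumLattice (LGConfig ZdEdge ZdPlaquette plaquetteObs)
open Literature.MathematicalPhysics.QuantumFieldTheory (ZdGaugeConfig zdHaar zdWilsonMeasure zdWilsonAction zdExpect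
  plaquettesIn)
open Literature.MathematicalPhysics.QuantumFieldTheory.AreaLaw (integrable_zdHaar_of_continuous continuous_plaquette
  zdExpect_eq_div_integral)
open Literature.MathematicalPhysics.QuantumFieldTheory.Chatterjee2019LargeN

namespace Summit.QuantumFields.GaugeBoot

namespace StringDuality

variable {d N : ℕ}

/-! ## Differentiation under the Haar integral -/

/-- **Differentiation under the integral sign on the compact configuration space**: for a continuous bounded `S`
(`|S| ≤ B`) and `k : ℕ`, `β ↦ ∫ (cS)^k e^{cβS} dg_∞` has derivative `∫ (cS)^{k+1} e^{cβS} dg_∞` everywhere. [folklore] -/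
theorem hasDerivAt_integral_pow_mul_exp {S : ZdGaugeConfig d (SO N) → ℝ} (hS : Continuous S) {B : ℝ}
    (hB : ∀ U, |S U| ≤ B) (c : ℝ) (k : ℕ) (β₀ : ℝ) :
    HasDerivAt (fun β : ℝ => ∫ U, (c * S U) ^ k * Real.exp (c * β * S U) ∂(zdHaar d (SO N)))
      (∫ U, (c * S U) ^ (k + 1) * Real.exp (c * β₀ * S U) ∂(zdHaar d (SO N))) β₀ := by
  have hB0 : 0 ≤ B := (abs_nonneg _).trans (hB 1)
  set bound : ZdGaugeConfig d (SO N) → ℝ := fun _ => (|c| * B) ^ (k + 1) * Real.exp (|c| * (|β₀| + 1) * B)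
    with hbound
  have hcont : ∀ β : ℝ, Continuous fun U => (c * S U) ^ k * Real.exp (c * β * S U) := fun β =>
    ((continuous_const.mul hS).pow k).mul (Real.continuous_exp.comp (continuous_const.mul hS))
  have hcont' : ∀ β : ℝ, Continuous fun U => (c * S U) ^ (k + 1) * Real.exp (c * β * S U) := fun β =>
    ((continuous_const.mul hS).pow (k + 1)).mul (Real.continuous_exp.comp (continuous_const.mul hS))
  have h := hasDerivAt_integral_of_dominated_loc_of_deriv_le (μ := zdHaar d (SO N)) (x₀ := β₀)
    (F := fun β U => (c * S U) ^ k * Real.exp (c * β * S U))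
    (F' := fun β U => (c * S U) ^ (k + 1) * Real.exp (c * β * S U)) (bound := bound)
    (Metric.ball_mem_nhds β₀ zero_lt_one)
    (Eventually.of_forall fun β => (hcont β).aestronglyMeasurable)
    (integrable_zdHaar_of_continuous (hcont β₀)) (hcont' β₀).aestronglyMeasurable ?_
    (integrable_const _) ?_
  · exact h.2
  · refine ae_of_all _ fun U β hβ => ?_
    rw [Metric.mem_ball, Real.dist_eq] at hβ
    have hβ' : |β| ≤ |β₀| + 1 := by
      have := abs_sub_abs_le_abs_sub β β₀
      linarith
    have hcS : |c * S U| ≤ |c| * B := by rw [abs_mul]; exact mul_le_mul_of_nonneg_left (hB U) (abs_nonneg c)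
    rw [Real.norm_eq_abs, abs_mul, abs_pow, Real.abs_exp, hbound]
    refine mul_le_mul (pow_le_pow_left₀ (abs_nonneg _) hcS _) (Real.exp_le_exp.mpr ?_) (Real.exp_pos _).le
      (by positivity)
    calc c * β * S U ≤ |c * β * S U| := le_abs_self _
      _ = |β| * |c * S U| := by rw [show c * β * S U = β * (c * S U) by ring, abs_mul]
      _ ≤ (|β₀| + 1) * (|c| * B) := mul_le_mul hβ' hcS (abs_nonneg _) (by positivity)
      _ = |c| * (|β₀| + 1) * B := by ring
  · refine ae_of_all _ fun U β _ => ?_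
    have h1 : HasDerivAt (fun β : ℝ => c * β * S U) (c * S U) β := by
      have := ((hasDerivAt_id β).const_mul c).mul_const (S U)
      simpa using this
    have h2 := (h1.exp).const_mul ((c * S U) ^ k)
    have e : (c * S U) ^ k * (Real.exp (c * β * S U) * (c * S U)) = (c * S U) ^ (k + 1) * Real.exp (c * β * S U) := by
      ring
    rw [e] at h2
    exact h2

/-! ## The log-partition identity -/

/-- The Chatterjee weight against the tree's Wilson action: for `SO(N)`,
`exp(−Nβ S_Λ(U)) = exp(−Nβ·N·|𝒫_Λ|) · exp(Nβ Σ_{p∈𝒫_Λ} tr Q_p)`. [cite: Chatterjee2019LargeN, §3 ¶1 (the density of μ_{Λ,N,β})] -/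
theorem exp_neg_mul_zdWilsonAction_soRep (β : ℝ) (Λ : Finset (Site d)) (U : ZdGaugeConfig d (SO N)) :
    Real.exp (-(N * β) * zdWilsonAction (soRep N) Λ U) =
      Real.exp (-(N * β) * (N * (plaquettesIn Λ).card)) *
        Real.exp (N * β * ∑ p ∈ plaquettesIn Λ,
          Matrix.trace ((ZdGaugeConfig.plaquette U p.1 p.2.1 p.2.2 : SO N) : Matrix (Fin N) (Fin N) ℝ)) := by
  rw [← Real.exp_add]
  congr 1
  unfold zdWilsonAction
  have h : ∀ p ∈ plaquettesIn Λ, ((N : ℝ) - ((soRep N) (ZdGaugeConfig.plaquette U p.1 p.2.1 p.2.2)).trace.re) =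
      (N : ℝ) - Matrix.trace ((ZdGaugeConfig.plaquette U p.1 p.2.1 p.2.2 : SO N) : Matrix (Fin N) (Fin N) ℝ) := by
    intro p _
    rw [soRep_apply, SOMasterLoop.trace_map_ofReal, Complex.ofReal_re]
  rw [Finset.sum_congr rfl h, Finset.sum_sub_distrib, Finset.sum_const, nsmul_eq_mul]
  ring

variable (N)

/-- ★ **The log-partition function as an integral of plaquette expectations**: for every finite `Λ ⊂ ℤ^d`, every `N`
and every real `β₁`, `log Z_{Λ,N,β₁} = ∫₀^{β₁} N Σ_{p ∈ 𝒫_Λ} ⟨tr Q_p⟩_{Λ,N,β} dβ`.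
[cite: Chatterjee2019LargeN, §15 (proof of Corollary 3.4: «log Z = Σ_p N ∫₀^{β₁} ⟨W_p⟩ dβ»)] -/
theorem log_soPartitionFunction_eq_integral (Λ : Finset (Site d)) (β₁ : ℝ) :
    Real.log (soPartitionFunction N β₁ Λ) =
      ∫ β in (0 : ℝ)..β₁, (N : ℝ) * ∑ p ∈ plaquettesIn Λ,
        soExpect N β Λ (fun U =>
          Matrix.trace ((ZdGaugeConfig.plaquette U p.1 p.2.1 p.2.2 : SO N) : Matrix (Fin N) (Fin N) ℝ)) := by
  have hρ : Continuous (soRep N) := (isSpecialOrthogonalModel_soRep N).1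
  -- the total plaquette trace `S` is continuous and bounded
  set S : ZdGaugeConfig d (SO N) → ℝ := fun U => ∑ p ∈ plaquettesIn Λ,
    Matrix.trace ((ZdGaugeConfig.plaquette U p.1 p.2.1 p.2.2 : SO N) : Matrix (Fin N) (Fin N) ℝ) with hSdef
  have hT : ∀ p : Site d × Fin d × Fin d, Continuous fun U : ZdGaugeConfig d (SO N) =>
      Matrix.trace ((ZdGaugeConfig.plaquette U p.1 p.2.1 p.2.2 : SO N) : Matrix (Fin N) (Fin N) ℝ) := fun p =>
    (continuous_subtype_val.comp (continuous_plaquette p.1 p.2.1 p.2.2)).matrix_trace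
  have hS : Continuous S := by
    rw [hSdef]
    exact continuous_finsetSum _ fun p _ => hT p
  obtain ⟨B, hB⟩ : ∃ B, ∀ U, |S U| ≤ B := by
    have hb := (isCompact_range hS).isBounded
    obtain ⟨B, hB⟩ := hb.subset_closedBall 0
    exact ⟨B, fun U => by simpa [Real.dist_eq] using hB (Set.mem_range_self U)⟩
  -- `Z(β) = ∫ e^{NβS}`, `Z₁(β) = ∫ NS e^{NβS}`
  set Z : ℝ → ℝ := fun β => ∫ U, Real.exp (N * β * S U) ∂(zdHaar d (SO N)) with hZ
  set Z₁ : ℝ → ℝ := fun β => ∫ U, (N : ℝ) * S U * Real.exp (N * β * S U) ∂(zdHaar d (SO N)) with hZ₁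
  have hZeq : ∀ β, soPartitionFunction N β Λ = Z β := fun β => rfl
  have hdZ : ∀ β, HasDerivAt Z (Z₁ β) β := fun β => by
    have h := hasDerivAt_integral_pow_mul_exp hS hB N 0 β
    simpa only [pow_zero, one_mul, zero_add, pow_one] using h
  have hdZ₁ : ∀ β, HasDerivAt Z₁ (∫ U, ((N : ℝ) * S U) ^ 2 * Real.exp (N * β * S U) ∂(zdHaar d (SO N))) β :=
    fun β => by
    have h := hasDerivAt_integral_pow_mul_exp hS hB N 1 β
    simpa only [pow_one] using h
  have hexpc : ∀ β : ℝ, Continuous fun U => Real.exp (N * β * S U) := fun β =>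
    Real.continuous_exp.comp (continuous_const.mul hS)
  have hZpos : ∀ β, 0 < Z β := by
    intro β
    have hlow : ∀ U, Real.exp (-(|(N : ℝ) * β| * B)) ≤ Real.exp (N * β * S U) := by
      intro U
      apply Real.exp_le_exp.mpr
      have : |(N : ℝ) * β * S U| ≤ |(N : ℝ) * β| * B := by
        rw [abs_mul]; exact mul_le_mul_of_nonneg_left (hB U) (abs_nonneg _)
      linarith [neg_abs_le ((N : ℝ) * β * S U)]
    calc (0 : ℝ) < Real.exp (-(|(N : ℝ) * β| * B)) := Real.exp_pos _
      _ = ∫ _U, Real.exp (-(|(N : ℝ) * β| * B)) ∂(zdHaar d (SO N)) := by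
          rw [integral_const, smul_eq_mul, probReal_univ, one_mul]
      _ ≤ Z β := integral_mono (integrable_const _) (integrable_zdHaar_of_continuous (hexpc β)) hlow
  -- the expectations as ratios
  have hE : ∀ (β : ℝ) (F : ZdGaugeConfig d (SO N) → ℝ), soExpect N β Λ F =
      (∫ U, F U * Real.exp (N * β * S U) ∂(zdHaar d (SO N))) / Z β := by
    intro β F
    have hc : Real.exp (-(N * β) * (N * (plaquettesIn Λ).card)) ≠ 0 := (Real.exp_pos _).ne'
    rw [soExpect_eq_zdExpect, zdExpect_eq_div_integral (soRep N) hρ (N * β) Λ F]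
    simp_rw [exp_neg_mul_zdWilsonAction_soRep]
    have h1 : (∫ U, F U * (Real.exp (-(N * β) * (N * (plaquettesIn Λ).card)) * Real.exp (N * β * S U))
        ∂(zdHaar d (SO N))) = Real.exp (-(N * β) * (N * (plaquettesIn Λ).card)) *
          ∫ U, F U * Real.exp (N * β * S U) ∂(zdHaar d (SO N)) := by
      rw [← integral_const_mul]
      refine integral_congr_ae (ae_of_all _ fun U => ?_)
      ring
    rw [h1, integral_const_mul, mul_div_mul_left _ _ hc]
  have hratio : ∀ β, (N : ℝ) * ∑ p ∈ plaquettesIn Λ, soExpect N β Λ (fun U =>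
      Matrix.trace ((ZdGaugeConfig.plaquette U p.1 p.2.1 p.2.2 : SO N) : Matrix (Fin N) (Fin N) ℝ)) = Z₁ β / Z β := by
    intro β
    have hint : ∀ p ∈ plaquettesIn Λ, Integrable (fun U => (N : ℝ) *
        (Matrix.trace ((ZdGaugeConfig.plaquette U p.1 p.2.1 p.2.2 : SO N) : Matrix (Fin N) (Fin N) ℝ) *
          Real.exp (N * β * S U))) (zdHaar d (SO N)) := fun p _ =>
      integrable_zdHaar_of_continuous (continuous_const.mul ((hT p).mul (hexpc β)))
    calc (N : ℝ) * ∑ p ∈ plaquettesIn Λ, soExpect N β Λ (fun U =>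
          Matrix.trace ((ZdGaugeConfig.plaquette U p.1 p.2.1 p.2.2 : SO N) : Matrix (Fin N) (Fin N) ℝ))
        = (N : ℝ) * ∑ p ∈ plaquettesIn Λ, (∫ U,
            Matrix.trace ((ZdGaugeConfig.plaquette U p.1 p.2.1 p.2.2 : SO N) : Matrix (Fin N) (Fin N) ℝ) *
              Real.exp (N * β * S U) ∂(zdHaar d (SO N))) / Z β := by
          simp_rw [hE]
      _ = (∑ p ∈ plaquettesIn Λ, (N : ℝ) * ∫ U,
            Matrix.trace ((ZdGaugeConfig.plaquette U p.1 p.2.1 p.2.2 : SO N) : Matrix (Fin N) (Fin N) ℝ) *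
              Real.exp (N * β * S U) ∂(zdHaar d (SO N))) / Z β := by
          rw [← Finset.sum_div, ← mul_div_assoc, Finset.mul_sum]
      _ = Z₁ β / Z β := by
          congr 1
          simp_rw [← integral_const_mul]
          rw [← integral_finsetSum _ hint, hZ₁]
          refine integral_congr_ae (ae_of_all _ fun U => ?_)
          simp only [hSdef, Finset.mul_sum, Finset.sum_mul]
          exact Finset.sum_congr rfl fun _ _ => by ring
  -- `log Z` and the fundamental theorem of calculus
  have hdlog : ∀ β, HasDerivAt (fun β => Real.log (Z β)) (Z₁ β / Z β) β := fun β =>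
    (hdZ β).log (hZpos β).ne'
  have hcontZ : Continuous Z := continuous_iff_continuousAt.mpr fun β => (hdZ β).continuousAt
  have hcontZ₁ : Continuous Z₁ := continuous_iff_continuousAt.mpr fun β => (hdZ₁ β).continuousAt
  have hcont : Continuous fun β => Z₁ β / Z β := hcontZ₁.div hcontZ fun β => (hZpos β).ne'
  have hftc := intervalIntegral.integral_eq_sub_of_hasDerivAt (f := fun β => Real.log (Z β)) (f' := fun β => Z₁ β / Z β)
    (a := 0) (b := β₁) (fun β _ => hdlog β) (hcont.intervalIntegrable _ _)
  have hZ0 : Z 0 = 1 := by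
    rw [hZ]
    simp only [mul_zero, zero_mul, Real.exp_zero]
    rw [integral_const, smul_eq_mul, probReal_univ, one_mul]
  simp_rw [hratio]
  rw [hftc, hZ0, Real.log_one, sub_zero, hZeq]

/-- ★ **The same identity in Chatterjee's normalisation**: `log Z_{Λ,N,β₁} = ∫₀^{β₁} N² Σ_{p ∈ 𝒫_Λ} φ_{Λ,N,β}((∂p)) dβ`, where
`φ_{Λ,N,β}((∂p)) = ⟨W_{∂p}⟩/N` and `∂p` is the plaquette word (`tr Q_p = W_{∂p}` for `SO(N)`).
[cite: Chatterjee2019LargeN, §15 (proof of Corollary 3.4)] -/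
theorem log_soPartitionFunction_eq_integral_phi (hN : N ≠ 0) (Λ : Finset (Site d)) (β₁ : ℝ) :
    Real.log (soPartitionFunction N β₁ Λ) =
      ∫ β in (0 : ℝ)..β₁, (N : ℝ) ^ 2 * ∑ p ∈ (plaquettesIn Λ).attach,
        phi N β Λ [plaquetteWord ⟨p.1.1, ⟨(p.1.2.1, p.1.2.2), (Iff.mp SOMasterLoop.mem_plaquettesIn_iff
          (show ((p.1.1, p.1.2.1, p.1.2.2) : Site d × Fin d × Fin d) ∈ plaquettesIn Λ from p.2)).1⟩⟩] := by
  have hN' : (N : ℝ) ≠ 0 := by exact_mod_cast hN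
  rw [log_soPartitionFunction_eq_integral]
  refine intervalIntegral.integral_congr fun β _ => ?_
  -- the plaquette trace is the Wilson loop variable of the plaquette word
  have hW : ∀ (q : ZdPlaquette d) (U : ZdGaugeConfig d (SO N)),
      Matrix.trace ((ZdGaugeConfig.plaquette U q.1 q.2.1.1 q.2.1.2 : SO N) : Matrix (Fin N) (Fin N) ℝ) =
        wilsonProd N [plaquetteWord q] U := by
    intro q U
    rw [wilsonProd, List.map_singleton, List.prod_cons, List.prod_nil, mul_one,
      ← SOMasterLoop.plaquetteObs_eq_wilsonLoopVar U q, plaquetteObs, soRep_apply, SOMasterLoop.trace_map_ofReal,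
      Complex.ofReal_re]
    rfl
  have hp : ∀ q : ZdPlaquette d,
      (N : ℝ) * soExpect N β Λ (fun U =>
        Matrix.trace ((ZdGaugeConfig.plaquette U q.1 q.2.1.1 q.2.1.2 : SO N) : Matrix (Fin N) (Fin N) ℝ)) =
        (N : ℝ) ^ 2 * phi N β Λ [plaquetteWord q] := by
    intro q
    have hfun : (fun U : ZdGaugeConfig d (SO N) =>
        Matrix.trace ((ZdGaugeConfig.plaquette U q.1 q.2.1.1 q.2.1.2 : SO N) : Matrix (Fin N) (Fin N) ℝ)) =
        wilsonProd N [plaquetteWord q] := funext fun U => hW q U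
    rw [hfun, phi]
    simp only [List.length_singleton, pow_one]
    field_simp
  calc (N : ℝ) * ∑ p ∈ plaquettesIn Λ, soExpect N β Λ (fun U =>
        Matrix.trace ((ZdGaugeConfig.plaquette U p.1 p.2.1 p.2.2 : SO N) : Matrix (Fin N) (Fin N) ℝ))
      = ∑ p ∈ (plaquettesIn Λ).attach, (N : ℝ) * soExpect N β Λ (fun U =>
        Matrix.trace ((ZdGaugeConfig.plaquette U p.1.1 p.1.2.1 p.1.2.2 : SO N) : Matrix (Fin N) (Fin N) ℝ)) := by
        rw [Finset.mul_sum, ← Finset.sum_attach]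
    _ = ∑ p ∈ (plaquettesIn Λ).attach, (N : ℝ) ^ 2 *
        phi N β Λ [plaquetteWord ⟨p.1.1, ⟨(p.1.2.1, p.1.2.2), (Iff.mp SOMasterLoop.mem_plaquettesIn_iff
          (show ((p.1.1, p.1.2.1, p.1.2.2) : Site d × Fin d × Fin d) ∈ plaquettesIn Λ from p.2)).1⟩⟩] :=
        Finset.sum_congr rfl fun p _ => hp ⟨p.1.1, ⟨(p.1.2.1, p.1.2.2), _⟩⟩
    _ = _ := by rw [← Finset.mul_sum]

end StringDuality

end Summit.QuantumFields.GaugeBoot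

end
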